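/-
Copyright (c) 2026 the pub-hodgecm-mathlib formalisation cell (harness21).  Prover seat hodgecm-mathlib-K2E4-p10 (g8), Track B «K2-LIT»,
#184♮ = hLiu418 = `stmt-HodgeConjecture-24832`; ROAD Φ of socket #41, TABLE #7 (h3), K2E4-p10's share `(w hw0 hws hg)` (desk K2E5-p17 (g8) 16:17:21Z ∕ «go» 16:24:41Z): the letter
(L-cnt) of ★ p861906 `summable_weight_of_latticeCount` REDUCED to one summability over a ℤ-lattice — «the denominator-`D` fibre counts like `D^k` copies of the base lattice».
THEOREMS ONLY (no `def`, no instance, no notation, no named-fact hypothesis, no `sorry`); Mathlib-level + ★ `summable_one_add_norm_rpow_neg`.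
-/
import Summits.HodgeConjecture.HodgeConjecture.Theorems.K2LiuHermTwoLatticeProdMajorant   -- ★ (K2E5-p16) `summable_one_add_norm_rpow_neg` (ℤ-lattice `Σ (1+‖z‖)^{−k} < ∞`, `rank < k`)
import HarnessLib

/-!
# Crux `HLiu418`, ROAD Φ of socket #41, (h3)∕(W3b) — `K2LiuLatticeFibreCount`: `Σ_{a : d(a) = D} (1+τ_a)^{−k} ≤ D^k · Σ_{z ∈ Λ₀} (1+‖z‖)^{−k}` ALONG AN INJECTION INTO A LATTICE

Cell `hodgecm-mathlib`, crux item hLiu418 = `stmt-HodgeConjecture-24832` (helper lane `--supports … --as helper`, count-neutral); squad K2 ∕ K2Liu, road `K2_Liu`, socket #41.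
Consumer: ★ p861906 `K2LiuWhittakerWeightedGrowthOfDecay.summable_weight_of_latticeCount`, whose letter (L-cnt) asks, for every denominator `D ≥ 1`, `Summable` + `Σ_{d_i = D}(1+τ_i)^{−k} ≤ C₁·D^{k₁}`.
THE MATHEMATICS ([MoeglinWaldspurger1995, I.2.2]; [BorelJacquet1979, §1.2]; folklore lattice counting).  The Fourier indices with exact denominator `D` w.r.t. a base lattice `Λ₀` (integral
skew-hermitian matrices) inject into `Λ₀` by `S ↦ D•S`, and `‖D•S‖ = D·‖S‖`; since `1 + ‖D•S‖ ≤ D·(1 + ‖S‖)` for `D ≥ 1`, each fibre term is `≤ D^k·(1+‖D•S‖)^{−k}`, so the fibre sum is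
`≤ D^k·Σ_{z∈Λ₀}(1+‖z‖)^{−k}`, finite for `k > rank Λ₀` (★ `summable_one_add_norm_rpow_neg`).  Stated ABSTRACTLY: any injection `φ : α → Λ` into a normed group with `‖φ a‖ ≤ D·τ_a`.
* §1 `inv_pow_le_of_norm_le` (the pointwise comparison), **`summable_and_tsum_fibre_le_of_injective`** ((L-cnt)'s two conjuncts with `C₁ := Σ_{Λ}(1+‖z‖)^{−k}`, `k₁ := k`).
* §2 **`summable_one_add_norm_pow_inv`** — the ℕ-power reading of ★ `summable_one_add_norm_rpow_neg` for a discrete ℤ-submodule `Λ₀` of a finite-dimensional real normed space, `rank Λ₀ < k`;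
  and the packaged **`latticeFibreCount`** = §1 ∘ §2 (the (L-cnt) letter for `φ_D : {d = D} ↪ Λ₀`).
NOT HERE: the concrete `τ`, `d`, `Λ₀`, `φ_D` on the TOP's index `skewMatrices` (F0P2-p08 (g0)'s `WT∕GW` data fix them).
HONEST LABEL.  Count-neutral helper; `HC_CM` is proved only modulo the 7 printed citations (2 remaining named inputs: hLiu418 = `stmt-HodgeConjecture-24832`,
h413 = `stmt-HodgeConjecture-24833`) until rung 0 closes.
-/

set_option autoImplicit false
set_option linter.dupNamespace false -- the mandated namespace repeats `HodgeConjecture.HodgeConjecture`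

noncomputable section

namespace Summit.HodgeConjecture.HodgeConjecture.Cruxes.HLiu418.K2LiuLatticeFibreCount

open Function
open scoped BigOperators
open K2LiuHermTwoLatticeProdMajorant (summable_one_add_norm_rpow_neg)

/-! ## §1 Fibre count along an injection into a normed group -/

/-- pointwise: `‖y‖ ≤ D·t`, `D ≥ 1`, `t ≥ 0` ⟹ `((1+t)^k)⁻¹ ≤ D^k·((1+‖y‖)^k)⁻¹` (`1 + ‖y‖ ≤ D(1+t)`). [folklore] -/
theorem inv_pow_le_of_norm_le {Λ : Type*} [NormedAddCommGroup Λ] {D t : ℝ} (hD : 1 ≤ D) (ht : 0 ≤ t) {y : Λ} (hy : ‖y‖ ≤ D * t) (k : ℕ) :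
    ((1 + t) ^ k)⁻¹ ≤ D ^ k * ((1 + ‖y‖) ^ k)⁻¹ := by
  have h1 : (0 : ℝ) < 1 + ‖y‖ := by positivity
  have h2 : (0 : ℝ) < 1 + t := by linarith
  have hle : 1 + ‖y‖ ≤ D * (1 + t) := by nlinarith
  rw [← div_eq_mul_inv, le_div_iff₀ (pow_pos h1 k)]
  calc ((1 + t) ^ k)⁻¹ * (1 + ‖y‖) ^ k ≤ ((1 + t) ^ k)⁻¹ * (D * (1 + t)) ^ k :=
        mul_le_mul_of_nonneg_left (pow_le_pow_left₀ h1.le hle k) (by positivity)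
    _ = D ^ k := by rw [mul_pow]; field_simp

/-- **FIBRE COUNT ALONG AN INJECTION**: `φ : α → Λ` injective into a normed group with `Σ_Λ (1+‖z‖)^{−k} < ∞`, sizes `τ ≥ 0` with `‖φ a‖ ≤ D·τ_a` (`D ≥ 1`) ⟹
`Summable (a ↦ ((1+τ_a)^k)⁻¹)` and `Σ_a ((1+τ_a)^k)⁻¹ ≤ D^k·Σ_{z∈Λ}((1+‖z‖)^k)⁻¹` — the two conjuncts of ★ p861906's (L-cnt) at denominator `D`. [cite: MoeglinWaldspurger1995, I.2.2]
[cite: BorelJacquet1979, §1.2] -/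
theorem summable_and_tsum_fibre_le_of_injective {Λ : Type*} [NormedAddCommGroup Λ] (k : ℕ) (hΛ : Summable fun z : Λ => ((1 + ‖z‖) ^ k)⁻¹)
    {α : Type*} (φ : α → Λ) (hφ : Injective φ) {D : ℝ} (hD : 1 ≤ D) (τ : α → ℝ) (hτ0 : ∀ a, 0 ≤ τ a) (hτ : ∀ a, ‖φ a‖ ≤ D * τ a) :
    Summable (fun a => ((1 + τ a) ^ k)⁻¹) ∧ ∑' a, ((1 + τ a) ^ k)⁻¹ ≤ D ^ k * ∑' z : Λ, ((1 + ‖z‖) ^ k)⁻¹ := by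
  have hpt : ∀ a, ((1 + τ a) ^ k)⁻¹ ≤ D ^ k * ((1 + ‖φ a‖) ^ k)⁻¹ := fun a => inv_pow_le_of_norm_le hD (hτ0 a) (hτ a) k
  have hnn : ∀ a, 0 ≤ ((1 + τ a) ^ k)⁻¹ := fun a => by have := hτ0 a; positivity
  have hcomp : Summable fun a => D ^ k * ((1 + ‖φ a‖) ^ k)⁻¹ := (hΛ.comp_injective hφ).mul_left (D ^ k)
  have hsum : Summable fun a => ((1 + τ a) ^ k)⁻¹ := Summable.of_nonneg_of_le hnn hpt hcomp
  refine ⟨hsum, ?_⟩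
  calc ∑' a, ((1 + τ a) ^ k)⁻¹ ≤ ∑' a, D ^ k * ((1 + ‖φ a‖) ^ k)⁻¹ := hsum.tsum_le_tsum hpt hcomp
    _ = D ^ k * ∑' a, ((1 + ‖φ a‖) ^ k)⁻¹ := tsum_mul_left
    _ ≤ D ^ k * ∑' z : Λ, ((1 + ‖z‖) ^ k)⁻¹ := by
        refine mul_le_mul_of_nonneg_left ?_ (by positivity)
        exact (hΛ.comp_injective hφ).tsum_le_tsum_of_inj φ hφ (fun z _ => by positivity) (fun a => le_rfl) hΛ

/-! ## §2 The base lattice: `Σ_{z∈Λ₀}((1+‖z‖)^k)⁻¹ < ∞` for `rank Λ₀ < k`; the packaged letter -/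

/-- **ℕ-power reading of ★ `summable_one_add_norm_rpow_neg`**: for a discrete ℤ-submodule `Λ₀` of a finite-dimensional real normed space and `rank Λ₀ < k`,
`Summable (z ↦ ((1+‖z‖)^k)⁻¹)` on `Λ₀`. [cite: MoeglinWaldspurger1995, I.2.2] -/
theorem summable_one_add_norm_pow_inv {V : Type*} [NormedAddCommGroup V] [NormedSpace ℝ V] [FiniteDimensional ℝ V]
    (Λ₀ : Submodule ℤ V) [DiscreteTopology Λ₀] {k : ℕ} (hk : Module.finrank ℤ Λ₀ < k) :
    Summable fun z : Λ₀ => ((1 + ‖z‖) ^ k)⁻¹ := by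
  have h := summable_one_add_norm_rpow_neg Λ₀ (k := (k : ℝ)) (by exact_mod_cast hk)
  refine h.congr fun z => ?_
  have hz : (0 : ℝ) ≤ 1 + ‖z‖ := by positivity
  rw [Real.rpow_neg hz, Real.rpow_natCast]

/-- **(L-cnt) PACKAGED**: a discrete ℤ-lattice `Λ₀` (`rank Λ₀ < k`), a fibre `α` (read `{S : d(S) = D}`) injecting into `Λ₀` by `φ` (read `S ↦ D•S`) with `‖φ a‖ ≤ D·τ_a` (read `τ(S) = ‖S‖_∞`)
⟹ `Summable (a ↦ ((1+τ_a)^k)⁻¹) ∧ Σ_a ((1+τ_a)^k)⁻¹ ≤ (Σ_{z∈Λ₀}((1+‖z‖)^k)⁻¹)·D^k` — ★ p861906's `hcnt D` with `C₁ := Σ_{Λ₀}((1+‖z‖)^k)⁻¹`, `k₁ := k`.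
[cite: MoeglinWaldspurger1995, I.2.2] [cite: BorelJacquet1979, §1.2] -/
theorem latticeFibreCount {V : Type*} [NormedAddCommGroup V] [NormedSpace ℝ V] [FiniteDimensional ℝ V]
    (Λ₀ : Submodule ℤ V) [DiscreteTopology Λ₀] {k : ℕ} (hk : Module.finrank ℤ Λ₀ < k)
    {α : Type*} (φ : α → Λ₀) (hφ : Injective φ) {D : ℝ} (hD : 1 ≤ D) (τ : α → ℝ) (hτ0 : ∀ a, 0 ≤ τ a) (hτ : ∀ a, ‖φ a‖ ≤ D * τ a) :
    Summable (fun a => ((1 + τ a) ^ k)⁻¹) ∧ ∑' a, ((1 + τ a) ^ k)⁻¹ ≤ (∑' z : Λ₀, ((1 + ‖z‖) ^ k)⁻¹) * D ^ k := by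
  obtain ⟨hs, hle⟩ := summable_and_tsum_fibre_le_of_injective k (summable_one_add_norm_pow_inv Λ₀ hk) φ hφ hD τ hτ0 hτ
  exact ⟨hs, by rwa [mul_comm] at hle⟩

/-- the constant `C₁ = Σ_{z∈Λ₀}((1+‖z‖)^k)⁻¹` is non-negative (★ p861906's `hC₁`). [folklore] -/
theorem tsum_one_add_norm_pow_inv_nonneg {V : Type*} [NormedAddCommGroup V] (Λ₀ : Submodule ℤ V) (k : ℕ) :
    0 ≤ ∑' z : Λ₀, ((1 + ‖z‖) ^ k)⁻¹ :=
  tsum_nonneg fun z => by positivity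

end Summit.HodgeConjecture.HodgeConjecture.Cruxes.HLiu418.K2LiuLatticeFibreCount

end
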